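import Mathlib
import HarnessLib
import Summits.Ventures.LatticeQCDFlow.Exactness.LatticeIndependenceSamplerAcceptanceCeiling
import Summits.Ventures.LatticeQCDFlow.Exactness.LatticeBoundedDifferences

/-!
# Acceptance controls total variation on a lattice of compact sites: `|∫ g d(π.tilted(−F)) − ∫ g dπ| ≤ 2M(1 − acc)` and `|Cov_{π.tilted(−F)} − Cov_π| ≤ 6ab(1 − acc)` for every independence sampler — the generic (compact-site) form of `SphereIndependenceSamplerTV`

HONEST FRAMING: exact (Metropolis-corrected) sampling algorithms for lattice gauge theory;
figures of merit are autocorrelation/cost numbers at stated couplings and volumes; no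
continuum-physics claim.

Venture `LatticeQCDFlow` (cell pub-lqcd), topic `Exactness`; FANOUT row 7 (`s0-cpn-null`).  NEW WORK
of the cell over this lineage's `Exactness/LatticeIndependenceSamplerAcceptanceCeiling.lean`
(`latticeIndep_meanAccept_eq`: the mean acceptance on `X^ι` in closed form) and
`Exactness/LatticeBoundedDifferences.lean` (a probability space is nonempty), with Mathlib's
`integral_tilted`; the proofs are those of the lattice-of-spheres file `SphereIndependenceSamplerTV`
(GEN-16 K₀) transported verbatim; nothing is cited as a fact.  Printed counterparts, NAMED ONLY:
lean-2's finite-state `Scaling/Acceptance.lean` (`accRate ≤ 1 − ‖p − q‖_TV`); Albergo–Kanwar–Shanahan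
2019 §II.  Sites `ι` (finite), compact metric `X` with a Borel probability measure `μ`, `π = ⊗_ι μ`,
`F` continuous on `X^ι`, `acc` the mean Metropolis acceptance of the independence sampler with target
`π.tilted(−F)` and proposal `π`.  The companion direction of the acceptance CEILINGS of this lineage:
whatever correlations the target has that the proposal lacks are paid for by rejections — the generic
form of the acceptance–footprint law's first step (`SphereLOFlowAcceptanceFootprint`).

## Content

* `integral_pi_tilted` — `∫ g d(π.tilted f) = ∫ e^f g dπ / ∫ e^f dπ`.
* **`latticeIndep_abs_integral_tilted_sub_integral_le`** — `|∫ g d(π.tilted(−F)) − ∫ g dπ| ≤ 2M·(1 − acc)`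
  for continuous `g` with `|g| ≤ M`.
* **`latticeIndep_abs_cov_tilted_sub_cov_le`** — `|Cov_{π.tilted(−F)}(X, Y) − Cov_π(X, Y)| ≤ 6ab·(1 − acc)`
  for continuous `X`, `Y` bounded by `a`, `b`.

NOT CLAIMED: the converse sandwich; non-compact sites; anything model-specific.
-/

noncomputable section

namespace Summit.Ventures.LatticeQCDFlow.Exactness

open Function Set Metric MeasureTheory
open scoped Topology

variable {ι : Type*} [Fintype ι] [DecidableEq ι]
variable {X : Type*} [MeasurableSpace X] [MetricSpace X] [CompactSpace X] [BorelSpace X]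
  (μ : Measure X) [IsProbabilityMeasure μ]

omit [DecidableEq ι] [MetricSpace X] [CompactSpace X] [BorelSpace X] [IsProbabilityMeasure μ] in
/-- Integrals against `π = ⊗_ι μ` tilted by an exponent `f`: `∫ g d(π.tilted f) = ∫ e^f g dπ / ∫ e^f dπ`. -/
theorem integral_pi_tilted (f g : (ι → X) → ℝ) :
    ∫ ω, g ω ∂(Measure.pi (fun _ : ι => μ)).tilted f =
      (∫ ω, Real.exp (f ω) * g ω ∂Measure.pi (fun _ : ι => μ)) / ∫ ω, Real.exp (f ω) ∂Measure.pi (fun _ : ι => μ) := by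
  rw [integral_tilted, ← integral_div]
  refine integral_congr_ae (ae_of_all _ fun ω => ?_)
  simp only [smul_eq_mul, div_mul_eq_mul_div]

/-! ## §1 Acceptance controls the total variation between target and proposal -/

section TV

omit [DecidableEq ι] in
/-- **ACCEPTANCE CONTROLS TOTAL VARIATION (compact sites).**  For a continuous log-weight `F` and a
continuous `g` with `|g| ≤ M` on `X^ι`: `|∫ g d(π.tilted(−F)) − ∫ g dπ| ≤ 2M·(1 − acc)`, `acc` the mean
Metropolis acceptance of the independence sampler with target `π.tilted(−F)` and proposal `π`. -/
theorem latticeIndep_abs_integral_tilted_sub_integral_le {F : (ι → X) → ℝ} (hF : Continuous F)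
    {g : (ι → X) → ℝ} (hg : Continuous g) {M : ℝ} (hM : ∀ ω, |g ω| ≤ M) :
    |∫ ω, g ω ∂(Measure.pi (fun _ : ι => μ)).tilted (fun ω => -F ω) -
        ∫ ω, g ω ∂Measure.pi (fun _ : ι => μ)| ≤
      2 * M * (1 - ∫ ω, (∫ ω', min 1 (Real.exp (F ω - F ω'))
          ∂Measure.pi (fun _ : ι => μ))
        ∂(Measure.pi (fun _ : ι => μ)).tilted (fun ω => -F ω)) := by
  set π : Measure (ι → X) := Measure.pi (fun _ : ι => μ)
    with hπ
  rw [latticeIndep_meanAccept_eq μ F, integral_pi_tilted μ]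
  set w : (ι → X) → ℝ := fun ω => Real.exp (-F ω) with hw
  set Z : ℝ := ∫ ω, w ω ∂π with hZ
  set I : ℝ := ∫ ω, ∫ ω', |w ω - w ω'| ∂π ∂π with hI
  have hwc : Continuous w := Real.continuous_exp.comp hF.neg
  have hwi : Integrable w π := integrable_pi_of_continuous _ hwc
  have hZpos : 0 < Z := integral_exp_pos hwi
  have hM0 : 0 ≤ M := le_trans (abs_nonneg _) (hM (Classical.choice
    (nonempty_of_isProbabilityMeasure π)))
  -- `min(w, w') = (w + w')/2 − |w − w'|/2` and the numerator of the acceptance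
  have habsc : ∀ ω, Continuous fun ω' => |w ω - w ω'| := fun ω => (continuous_const.sub hwc).abs
  have hinner : ∀ ω, ∫ ω', Real.exp (-max (F ω) (F ω')) ∂π =
      (1 / 2) * w ω + (1 / 2) * Z - (1 / 2) * ∫ ω', |w ω - w ω'| ∂π := by
    intro ω
    have e : ∀ ω', Real.exp (-max (F ω) (F ω')) =
        ((1 / 2) * w ω + (1 / 2) * w ω') - (1 / 2) * |w ω - w ω'| := by
      intro ω'
      simp only [hw]
      rcases le_total (F ω) (F ω') with h | h
      · rw [max_eq_right h, abs_of_nonneg (sub_nonneg.2 (Real.exp_le_exp.2 (neg_le_neg h)))]; ring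
      · rw [max_eq_left h, abs_of_nonpos (sub_nonpos.2 (Real.exp_le_exp.2 (neg_le_neg h)))]; ring
    simp_rw [e]
    have hi1 : Integrable (fun ω' => (1 / 2) * w ω') π := hwi.const_mul _
    have hi2 : Integrable (fun ω' => (1 / 2) * w ω + (1 / 2) * w ω') π := (integrable_const _).add hi1
    have hi3 : Integrable (fun ω' => (1 / 2) * |w ω - w ω'|) π :=
      (integrable_pi_of_continuous _ (habsc ω)).const_mul _
    rw [integral_sub hi2 hi3, integral_add (integrable_const _) hi1, integral_const_mul,
      integral_const_mul, integral_const_mul, integral_const, smul_eq_mul, probReal_univ, one_mul,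
      ← hZ]
  have hIc : Continuous fun ω => ∫ ω', |w ω - w ω'| ∂π := by
    have hf : Continuous (uncurry fun (ω : ι → X) (ω' : ι → X) =>
        |w ω - w ω'|) := ((hwc.comp continuous_fst).sub (hwc.comp continuous_snd)).abs
    have h := continuous_parametric_integral_of_continuous (μ := π) hf isCompact_univ
    simp only [Measure.restrict_univ] at h
    exact h
  have hIi : Integrable (fun ω => ∫ ω', |w ω - w ω'| ∂π) π := integrable_pi_of_continuous _ hIc
  have hN : ∫ ω, ∫ ω', Real.exp (-max (F ω) (F ω')) ∂π ∂π = Z - (1 / 2) * I := by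
    simp_rw [hinner]
    have hi1 : Integrable (fun ω => (1 / 2) * w ω) π := hwi.const_mul _
    have hi2 : Integrable (fun ω => (1 / 2) * w ω + (1 / 2) * Z) π := hi1.add (integrable_const _)
    have hi3 : Integrable (fun ω => (1 / 2) * ∫ ω', |w ω - w ω'| ∂π) π := hIi.const_mul _
    rw [integral_sub hi2 hi3, integral_add hi1 (integrable_const _), integral_const_mul,
      integral_const_mul, integral_const_mul, integral_const, smul_eq_mul, probReal_univ, one_mul,
      ← hZ, ← hI]
    ring
  -- `1 − acc = I/(2Z)`
  have hacc : 1 - (Z - (1 / 2) * I) / Z = I / (2 * Z) := by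
    have hZ0 : Z ≠ 0 := hZpos.ne'
    field_simp
    try ring
  rw [hN, hacc]
  -- the difference of the two expectations is `(∫ (w − Z) g)/Z`
  have hgi : Integrable g π := integrable_pi_of_continuous _ hg
  have hwgi : Integrable (fun ω => w ω * g ω) π := integrable_pi_of_continuous _ (hwc.mul hg)
  have hdiff : (∫ ω, w ω * g ω ∂π) / Z - ∫ ω, g ω ∂π = (∫ ω, (w ω - Z) * g ω ∂π) / Z := by
    have e : ∀ ω, (w ω - Z) * g ω = w ω * g ω - Z * g ω := by intro ω; ring
    simp_rw [e]
    rw [integral_sub hwgi (hgi.const_mul Z), integral_const_mul]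
    field_simp
  rw [hdiff, abs_div, abs_of_pos hZpos, div_le_iff₀ hZpos]
  -- `|∫ (w − Z) g| ≤ M ∫ |w − Z| ≤ M · I`
  have h1 : |∫ ω, (w ω - Z) * g ω ∂π| ≤ M * ∫ ω, |w ω - Z| ∂π := by
    refine (abs_integral_le_integral_abs).trans ?_
    rw [← integral_const_mul]
    refine integral_mono ((integrable_pi_of_continuous _ ((hwc.sub continuous_const).mul hg)).abs)
      ((integrable_pi_of_continuous _ (hwc.sub continuous_const).abs).const_mul M) fun ω => ?_
    simp only
    rw [abs_mul, mul_comm M]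
    exact mul_le_mul_of_nonneg_left (hM ω) (abs_nonneg _)
  have h2 : ∫ ω, |w ω - Z| ∂π ≤ I := by
    refine integral_mono (integrable_pi_of_continuous _ (hwc.sub continuous_const).abs) hIi fun ω => ?_
    simp only
    have e : w ω - Z = ∫ ω', (w ω - w ω') ∂π := by
      rw [integral_sub (integrable_const _) hwi, integral_const, smul_eq_mul, probReal_univ, one_mul]
    rw [e]
    exact abs_integral_le_integral_abs
  calc |∫ ω, (w ω - Z) * g ω ∂π| ≤ M * I := h1.trans (mul_le_mul_of_nonneg_left h2 hM0)
    _ = 2 * M * (I / (2 * Z)) * Z := by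
        have hZ0 : Z ≠ 0 := hZpos.ne'
        field_simp
        try ring

omit [DecidableEq ι] in
/-- **ACCEPTANCE CONTROLS THE CHANGE OF COVARIANCES**: for continuous `U`, `V` on `X^ι` bounded by
`a`, `b`: `|Cov_{π.tilted(−F)}(U, V) − Cov_π(U, V)| ≤ 6ab·(1 − acc)`. -/
theorem latticeIndep_abs_cov_tilted_sub_cov_le {F : (ι → X) → ℝ} (hF : Continuous F)
    {U V : (ι → X) → ℝ} (hU : Continuous U) (hV : Continuous V) {a b : ℝ}
    (ha : ∀ ω, |U ω| ≤ a) (hb : ∀ ω, |V ω| ≤ b) :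
    |(∫ ω, U ω * V ω ∂(Measure.pi (fun _ : ι => μ)).tilted (fun ω => -F ω) -
        (∫ ω, U ω ∂(Measure.pi (fun _ : ι => μ)).tilted (fun ω => -F ω)) *
          ∫ ω, V ω ∂(Measure.pi (fun _ : ι => μ)).tilted (fun ω => -F ω)) -
      (∫ ω, U ω * V ω ∂Measure.pi (fun _ : ι => μ) -
        (∫ ω, U ω ∂Measure.pi (fun _ : ι => μ)) *
          ∫ ω, V ω ∂Measure.pi (fun _ : ι => μ))| ≤
      6 * (a * b) * (1 - ∫ ω, (∫ ω', min 1 (Real.exp (F ω - F ω'))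
          ∂Measure.pi (fun _ : ι => μ))
        ∂(Measure.pi (fun _ : ι => μ)).tilted (fun ω => -F ω)) := by
  set π : Measure (ι → X) := Measure.pi (fun _ : ι => μ)
    with hπ
  set ν : Measure (ι → X) := π.tilted (fun ω => -F ω) with hν
  set r : ℝ := 1 - ∫ ω, (∫ ω', min 1 (Real.exp (F ω - F ω')) ∂π) ∂ν with hr
  have ha0 : 0 ≤ a := le_trans (abs_nonneg _) (ha (Classical.choice (nonempty_of_isProbabilityMeasure π)))
  have hb0 : 0 ≤ b := le_trans (abs_nonneg _) (hb (Classical.choice (nonempty_of_isProbabilityMeasure π)))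
  -- the three total-variation estimates
  have hXY : |∫ ω, U ω * V ω ∂ν - ∫ ω, U ω * V ω ∂π| ≤ 2 * (a * b) * r :=
    latticeIndep_abs_integral_tilted_sub_integral_le μ hF (g := fun ω => U ω * V ω) (hU.mul hV) fun ω => by
      show |U ω * V ω| ≤ a * b
      rw [abs_mul]; exact mul_le_mul (ha ω) (hb ω) (abs_nonneg _) ha0
  have hXd : |∫ ω, U ω ∂ν - ∫ ω, U ω ∂π| ≤ 2 * a * r := latticeIndep_abs_integral_tilted_sub_integral_le μ hF hU ha
  have hYd : |∫ ω, V ω ∂ν - ∫ ω, V ω ∂π| ≤ 2 * b * r := latticeIndep_abs_integral_tilted_sub_integral_le μ hF hV hb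
  -- bounds on the means
  haveI : IsProbabilityMeasure ν :=
    isProbabilityMeasure_tilted (integrable_pi_of_continuous μ (Real.continuous_exp.comp hF.neg))
  have hmean : ∀ {ρ : Measure (ι → X)} [IsProbabilityMeasure ρ] {U : (ι → X) → ℝ}
      {s : ℝ}, Continuous U → (∀ ω, |U ω| ≤ s) → |∫ ω, U ω ∂ρ| ≤ s := by
    intro ρ _ U s hU hs
    refine (abs_integral_le_integral_abs).trans ?_
    have h := integral_mono (μ := ρ) ((hU.integrable_of_hasCompactSupport
      (HasCompactSupport.of_compactSpace _)).abs) (integrable_const s) hs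
    simp only [integral_const, smul_eq_mul, probReal_univ, one_mul] at h
    exact h
  have hXν : |∫ ω, U ω ∂ν| ≤ a := hmean hU ha
  have hYμ : |∫ ω, V ω ∂π| ≤ b := hmean hV hb
  -- algebra
  have e : (∫ ω, U ω * V ω ∂ν - (∫ ω, U ω ∂ν) * ∫ ω, V ω ∂ν) -
      (∫ ω, U ω * V ω ∂π - (∫ ω, U ω ∂π) * ∫ ω, V ω ∂π) =
      (∫ ω, U ω * V ω ∂ν - ∫ ω, U ω * V ω ∂π) -
        ((∫ ω, U ω ∂ν) * ((∫ ω, V ω ∂ν) - ∫ ω, V ω ∂π) +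
          ((∫ ω, U ω ∂ν) - ∫ ω, U ω ∂π) * ∫ ω, V ω ∂π) := by ring
  rw [e]
  refine (abs_sub _ _).trans ?_
  have h2 : |(∫ ω, U ω ∂ν) * ((∫ ω, V ω ∂ν) - ∫ ω, V ω ∂π) +
      ((∫ ω, U ω ∂ν) - ∫ ω, U ω ∂π) * ∫ ω, V ω ∂π| ≤ a * (2 * b * r) + (2 * a * r) * b := by
    refine (abs_add_le _ _).trans ?_
    rw [abs_mul, abs_mul]
    exact add_le_add (mul_le_mul hXν hYd (abs_nonneg _) ha0)
      (mul_le_mul hXd hYμ (abs_nonneg _) (le_trans (abs_nonneg _) hXd))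
  linarith

end TV

end Summit.Ventures.LatticeQCDFlow.Exactness

end
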